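import Mathlib
import Summits.Ventures.PercRepro2.Defs
import Summits.Ventures.PercRepro2.Independence
import Summits.Ventures.PercRepro2.Graph
import Summits.Ventures.PercRepro2.Exploration

/-!
# Cut-vertex decompositions: side configurations, the path lemma, the product law

Vocabulary for the cut-vertex theorems of rows 2′CUTV (mine-2, MINE2-CUTVERTEX.md §2, §10, §12)
and 2′RB (mine-a, MINEA-RBTREE.md §9), on the single-graph framework of `Graph.lean`.

* `CutV.IsCut ends x VA VB EA EB` — `x` is a cut vertex: `VA`, `VB` are disjoint vertex sets
  avoiding `x`, and the edges are partitioned into `EA ⊆ within (VA ∪ {x})` and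
  `EB ⊆ within (VB ∪ {x})` (loops at `x` may be put on either side).
* the side configurations are `restrict EA ω`, `restrict EB ω` (`Exploration.lean`): percolation
  on the part `A` (resp. `B`) on the same probability space.
* `CutV.collapse S x` — the map fixing `S` and sending everything else to `x`; open edges of `ω`
  are sent to open edges of `restrict EA ω` or to loops (`adj_collapse`), hence
  `conn_collapse`: `u ↔ v` in `ω` implies `collapse u ↔ collapse v` inside `A`.
* **Path lemma**: on `VA ∪ {x}` connectivity is decided by the `A`-edges (`conn_iff_restrict`);
  across the cut, `u ↔ v` iff `u ↔ x` inside `A` and `x ↔ v` inside `B` (`conn_across_iff`);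
  clusters: `cluster_restrict_subset`, `cluster_inter_eq`, `cluster_eq_union`,
  `cluster_eq_of_not_conn` ("a cluster of `l ∈ A` enters `B` only through `x`, and then continues
  as the `B`-cluster of `x`").
* **Product law**: events determined by the two sides are independent
  (`prob_sideEvent_inter_eq_mul`) — "the fibre is the product of the fibres"; the two-point
  function factorises across the cut (`prob_connEvent_across_eq_mul`).
-/

namespace Summit.Ventures.PercRepro2.CutV

variable {V : Type*} {E : Type*}

/-- `x` is a cut vertex of `ends` separating the vertex sets `VA` and `VB`, with the edge
partition `EA` (edges inside `VA ∪ {x}`) / `EB` (edges inside `VB ∪ {x}`). -/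
structure IsCut (ends : E → Sym2 V) (x : V) (VA VB : Set V) (EA EB : Set E) : Prop where
  /-- The two sides are disjoint. -/
  disj : Disjoint VA VB
  /-- The cut vertex is not on the `A`-side. -/
  x_notA : x ∉ VA
  /-- The cut vertex is not on the `B`-side. -/
  x_notB : x ∉ VB
  /-- `A`-edges lie inside `VA ∪ {x}`. -/
  EA_sub : EA ⊆ within ends (VA ∪ {x})
  /-- `B`-edges lie inside `VB ∪ {x}`. -/
  EB_sub : EB ⊆ within ends (VB ∪ {x})
  /-- Every edge is on one of the two sides. -/
  cover : ∀ e, e ∈ EA ∨ e ∈ EB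
  /-- No edge is on both sides. -/
  Edisj : Disjoint EA EB

variable {ends : E → Sym2 V} {x : V} {VA VB : Set V} {EA EB : Set E}

/-- A cut-vertex decomposition read from the other side. -/
lemma IsCut.symm (h : IsCut ends x VA VB EA EB) : IsCut ends x VB VA EB EA :=
  ⟨h.disj.symm, h.x_notB, h.x_notA, h.EB_sub, h.EA_sub, fun e => (h.cover e).symm, h.Edisj.symm⟩

/-- A `B`-vertex is not on the `A`-side `VA ∪ {x}`. -/
lemma IsCut.notMem_of_mem_B (h : IsCut ends x VA VB EA EB) {v : V} (hv : v ∈ VB) :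
    v ∉ VA ∪ {x} := by
  rintro (hvA | hvx)
  · exact Set.disjoint_left.mp h.disj hvA hv
  · rw [Set.mem_singleton_iff] at hvx
    exact h.x_notB (hvx ▸ hv)

/-- Both endpoints of an `A`-edge lie on the `A`-side. -/
lemma IsCut.ends_mem_of_mem_EA (h : IsCut ends x VA VB EA EB) {e : E} (he : e ∈ EA) {a b : V}
    (hab : ends e = s(a, b)) : a ∈ VA ∪ {x} ∧ b ∈ VA ∪ {x} := by
  obtain ⟨a', ha', b', hb', h'⟩ := h.EA_sub he
  rw [hab] at h'
  rcases Sym2.eq_iff.mp h' with ⟨rfl, rfl⟩ | ⟨rfl, rfl⟩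
  · exact ⟨ha', hb'⟩
  · exact ⟨hb', ha'⟩

open Classical in
/-- The collapse map onto `S`: vertices of `S` are fixed, everything else goes to `x`. -/
noncomputable def collapse (S : Set V) (x : V) (v : V) : V := if v ∈ S then v else x

/-- `collapse` fixes `S`. -/
lemma collapse_of_mem {S : Set V} {v : V} (hv : v ∈ S) : collapse S x v = v := by
  simp only [collapse, if_pos hv]

/-- `collapse` sends the complement of `S` to `x`. -/
lemma collapse_of_notMem {S : Set V} {v : V} (hv : v ∉ S) : collapse S x v = x := by
  simp only [collapse, if_neg hv]

/-- Every `B`-side vertex collapses to `x` under the `A`-collapse. -/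
lemma IsCut.collapse_eq_of_mem_B (h : IsCut ends x VA VB EA EB) {v : V} (hv : v ∈ VB ∪ {x}) :
    collapse (VA ∪ {x}) x v = x := by
  rcases hv with hv | hv
  · exact collapse_of_notMem (h.notMem_of_mem_B hv)
  · rw [Set.mem_singleton_iff] at hv
    rw [hv]
    exact collapse_of_mem (Or.inr rfl)

section Side

variable [DecidablePred (· ∈ EA)]

/-- One open edge of `ω` becomes an open edge of the `A`-side (if it is an `A`-edge) or a loop at
`x` (if it is a `B`-edge) under the `A`-collapse. -/
lemma adj_collapse (h : IsCut ends x VA VB EA EB) {ω : Config E} {a b : V}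
    (hab : (openGraph ends ω).Adj a b) :
    Conn ends (restrict EA ω) (collapse (VA ∪ {x}) x a) (collapse (VA ∪ {x}) x b) := by
  rw [openGraph_adj] at hab
  obtain ⟨_, e, he, hends⟩ := hab
  rcases h.cover e with hA | hB
  · obtain ⟨ha, hb⟩ := h.ends_mem_of_mem_EA hA hends
    rw [collapse_of_mem ha, collapse_of_mem hb]
    refine conn_of_openAdj ⟨e, ?_, hends⟩
    rw [restrict_apply_of_mem hA]
    exact he
  · obtain ⟨ha, hb⟩ := h.symm.ends_mem_of_mem_EA hB hends
    rw [h.collapse_eq_of_mem_B ha, h.collapse_eq_of_mem_B hb]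
    exact conn_refl _ _ _

/-- **Collapse lemma**: a connection in `ω` collapses to a connection inside the `A`-side. -/
theorem conn_collapse (h : IsCut ends x VA VB EA EB) {ω : Config E} {u v : V}
    (huv : Conn ends ω u v) :
    Conn ends (restrict EA ω) (collapse (VA ∪ {x}) x u) (collapse (VA ∪ {x}) x v) := by
  rw [Conn, SimpleGraph.reachable_iff_reflTransGen] at huv
  induction huv with
  | refl => exact conn_refl _ _ _
  | tail _ hab ih => exact conn_trans ih (adj_collapse h hab)

/-- **Path lemma, same side**: for `u, v ∈ VA ∪ {x}`, `u ↔ v` in `ω` iff `u ↔ v` using the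
`A`-edges alone. -/
theorem conn_iff_restrict (h : IsCut ends x VA VB EA EB) {ω : Config E} {u v : V}
    (hu : u ∈ VA ∪ {x}) (hv : v ∈ VA ∪ {x}) :
    Conn ends ω u v ↔ Conn ends (restrict EA ω) u v := by
  constructor
  · intro huv
    have key := conn_collapse h huv
    rwa [collapse_of_mem hu, collapse_of_mem hv] at key
  · exact conn_mono (restrict_le EA ω)

/-- **Path lemma, across the cut**: for `u ∈ VA`, `v ∈ VB`, `u ↔ v` iff `u ↔ x` inside `A` and
`x ↔ v` inside `B`. -/
theorem conn_across_iff [DecidablePred (· ∈ EB)] (h : IsCut ends x VA VB EA EB) {ω : Config E}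
    {u v : V} (hu : u ∈ VA) (hv : v ∈ VB) :
    Conn ends ω u v ↔ Conn ends (restrict EA ω) u x ∧ Conn ends (restrict EB ω) x v := by
  constructor
  · intro huv
    refine ⟨?_, ?_⟩
    · have key := conn_collapse h huv
      rwa [collapse_of_mem (S := VA ∪ {x}) (Or.inl hu), h.collapse_eq_of_mem_B (Or.inl hv)] at key
    · have key := conn_collapse h.symm huv
      rwa [h.symm.collapse_eq_of_mem_B (Or.inl hu), collapse_of_mem (S := VB ∪ {x}) (Or.inl hv)]
        at key
  · rintro ⟨h1, h2⟩
    exact conn_trans (conn_mono (restrict_le EA ω) h1) (conn_mono (restrict_le EB ω) h2)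

/-- A side cluster stays on its side. -/
theorem cluster_restrict_subset (h : IsCut ends x VA VB EA EB) {ω : Config E} {u : V}
    (hu : u ∈ VA ∪ {x}) : cluster ends (restrict EA ω) u ⊆ VA ∪ {x} := by
  intro v hv
  refine mem_of_conn_of_closed (S := VA ∪ {x}) ?_ hu hv
  intro a _ b hab
  rw [openGraph_adj] at hab
  obtain ⟨_, e, he, hends⟩ := hab
  have heA : e ∈ EA := by
    by_contra hcon
    rw [restrict_apply_of_notMem hcon] at he
    exact Bool.false_ne_true he
  exact (h.ends_mem_of_mem_EA heA hends).2

/-- The cluster of `u ∈ VA ∪ {x}` meets the `A`-side exactly in its `A`-side cluster: a cluster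
enters the other side only through `x`. -/
theorem cluster_inter_eq (h : IsCut ends x VA VB EA EB) {ω : Config E} {u : V}
    (hu : u ∈ VA ∪ {x}) :
    cluster ends ω u ∩ (VA ∪ {x}) = cluster ends (restrict EA ω) u := by
  ext v
  constructor
  · rintro ⟨hv, hvS⟩
    exact (conn_iff_restrict h hu hvS).mp hv
  · intro hv
    exact ⟨conn_mono (restrict_le EA ω) hv, cluster_restrict_subset h hu hv⟩

/-- For `u ∈ VA`: the cluster of `u` contains `x` iff `u ↔ x` inside `A`. -/
theorem mem_cluster_x_iff (h : IsCut ends x VA VB EA EB) {ω : Config E} {u : V} (hu : u ∈ VA) :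
    x ∈ cluster ends ω u ↔ Conn ends (restrict EA ω) u x :=
  conn_iff_restrict h (Or.inl hu) (Or.inr rfl)

/-- For `u ∈ VA` and `v ∈ VB`: `v` lies in the cluster of `u` iff `x` does and `v` lies in the
`B`-side cluster of `x`. -/
theorem mem_cluster_of_mem_B_iff [DecidablePred (· ∈ EB)] (h : IsCut ends x VA VB EA EB)
    {ω : Config E} {u v : V} (hu : u ∈ VA) (hv : v ∈ VB) :
    v ∈ cluster ends ω u ↔ x ∈ cluster ends ω u ∧ v ∈ cluster ends (restrict EB ω) x := by
  rw [mem_cluster_x_iff h hu]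
  exact conn_across_iff h hu hv

omit [DecidablePred (· ∈ EA)] in
/-- Vertices off `VA ∪ VB ∪ {x}` are isolated: a connection starting in `VA ∪ VB ∪ {x}` stays
there. -/
theorem mem_union_of_conn (h : IsCut ends x VA VB EA EB) {ω : Config E} {u v : V}
    (hu : u ∈ VA ∪ VB ∪ {x}) (huv : Conn ends ω u v) : v ∈ VA ∪ VB ∪ {x} := by
  refine mem_of_conn_of_closed (S := VA ∪ VB ∪ {x}) ?_ hu huv
  intro a _ b hab
  rw [openGraph_adj] at hab
  obtain ⟨_, e, _, hends⟩ := hab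
  rcases h.cover e with hA | hB
  · rcases (h.ends_mem_of_mem_EA hA hends).2 with hb | hb
    · exact Or.inl (Or.inl hb)
    · exact Or.inr hb
  · rcases (h.symm.ends_mem_of_mem_EA hB hends).2 with hb | hb
    · exact Or.inl (Or.inr hb)
    · exact Or.inr hb

/-- The cluster of `u ∈ VA` when `u ↔ x` inside `A`: the `A`-side cluster of `u` together with the
`B`-side cluster of `x` ("`RL = RL_A ∪ RX_B` if `x ∈ RL_A`"). -/
theorem cluster_eq_union [DecidablePred (· ∈ EB)] (h : IsCut ends x VA VB EA EB) {ω : Config E}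
    {u : V} (hu : u ∈ VA) (hx : Conn ends (restrict EA ω) u x) :
    cluster ends ω u = cluster ends (restrict EA ω) u ∪ cluster ends (restrict EB ω) x := by
  ext v
  constructor
  · intro hv
    rcases mem_union_of_conn h (Or.inl (Or.inl hu)) hv with (hvA | hvB) | hvx
    · exact Or.inl ((conn_iff_restrict h (Or.inl hu) (Or.inl hvA)).mp hv)
    · exact Or.inr ((conn_across_iff h hu hvB).mp hv).2
    · exact Or.inl ((conn_iff_restrict h (Or.inl hu) (Or.inr hvx)).mp hv)
  · rintro (hv | hv)
    · exact conn_mono (restrict_le EA ω) hv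
    · exact conn_trans (conn_mono (restrict_le EA ω) hx) (conn_mono (restrict_le EB ω) hv)

/-- The cluster of `u ∈ VA` when `u ↮ x` inside `A`: just the `A`-side cluster
("`RL = RL_A` if `x ∉ RL_A`"). -/
theorem cluster_eq_of_not_conn [DecidablePred (· ∈ EB)] (h : IsCut ends x VA VB EA EB)
    {ω : Config E} {u : V} (hu : u ∈ VA) (hx : ¬ Conn ends (restrict EA ω) u x) :
    cluster ends ω u = cluster ends (restrict EA ω) u := by
  ext v
  constructor
  · intro hv
    rcases mem_union_of_conn h (Or.inl (Or.inl hu)) hv with (hvA | hvB) | hvx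
    · exact (conn_iff_restrict h (Or.inl hu) (Or.inl hvA)).mp hv
    · exact absurd ((conn_across_iff h hu hvB).mp hv).1 hx
    · exact (conn_iff_restrict h (Or.inl hu) (Or.inr hvx)).mp hv
  · exact conn_mono (restrict_le EA ω)

end Side

/-- The event "`restrict F ω ∈ A`": the event `A` read on the side `F`. -/
def sideEvent (F : Set E) [DecidablePred (· ∈ F)] (A : Set (Config E)) : Set (Config E) :=
  {ω | restrict F ω ∈ A}

/-- Membership in `sideEvent`. -/
lemma mem_sideEvent {F : Set E} [DecidablePred (· ∈ F)] {A : Set (Config E)} {ω : Config E} :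
    ω ∈ sideEvent F A ↔ restrict F ω ∈ A := Iff.rfl

/-- A side event depends only on its side. -/
lemma dependsOn_sideEvent (F : Set E) [DecidablePred (· ∈ F)] (A : Set (Config E)) :
    DependsOn (· ∈ sideEvent F A) F :=
  dependsOn_restrict F (· ∈ A)

/-- **Product law**: events read on the two sides of a cut vertex are independent. -/
theorem prob_sideEvent_inter_eq_mul [Fintype E] [DecidableEq E] {R : Type*} [CommRing R]
    (p : E → R) [DecidablePred (· ∈ EA)] [DecidablePred (· ∈ EB)]
    (h : IsCut ends x VA VB EA EB) (A B : Set (Config E)) :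
    prob p (sideEvent EA A ∩ sideEvent EB B) = prob p (sideEvent EA A) * prob p (sideEvent EB B) :=
  prob_inter_eq_mul_of_dependsOn p h.Edisj (dependsOn_sideEvent EA A) (dependsOn_sideEvent EB B)

section Events

variable [DecidablePred (· ∈ EA)]

/-- The connection event of two `A`-side vertices is read on the `A`-side. -/
theorem connEvent_eq_sideEvent (h : IsCut ends x VA VB EA EB) {u v : V} (hu : u ∈ VA ∪ {x})
    (hv : v ∈ VA ∪ {x}) : connEvent ends u v = sideEvent EA (connEvent ends u v) := by
  ext ω
  exact conn_iff_restrict h hu hv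

/-- Across the cut, the connection event is the intersection of the two side events
`{u ↔ x in A}` and `{x ↔ v in B}`. -/
theorem connEvent_across_eq [DecidablePred (· ∈ EB)] (h : IsCut ends x VA VB EA EB) {u v : V}
    (hu : u ∈ VA) (hv : v ∈ VB) :
    connEvent ends u v = sideEvent EA (connEvent ends u x) ∩ sideEvent EB (connEvent ends x v) := by
  ext ω
  exact conn_across_iff h hu hv

/-- **Cut-vertex factorisation of the two-point function**: for `u ∈ VA`, `v ∈ VB`,
`P(u ↔ v) = P_A(u ↔ x) · P_B(x ↔ v)`. -/
theorem prob_connEvent_across_eq_mul [Fintype E] [DecidableEq E] {R : Type*} [CommRing R]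
    (p : E → R) [DecidablePred (· ∈ EB)] (h : IsCut ends x VA VB EA EB) {u v : V} (hu : u ∈ VA)
    (hv : v ∈ VB) :
    prob p (connEvent ends u v) =
      prob p (sideEvent EA (connEvent ends u x)) * prob p (sideEvent EB (connEvent ends x v)) := by
  rw [connEvent_across_eq h hu hv]
  exact prob_sideEvent_inter_eq_mul p h _ _

end Events

end Summit.Ventures.PercRepro2.CutV
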